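import Literature.AlgebraicGeometry.Motives.HodgeLieWeightOneSimpleOfRankFour
import Literature.AlgebraicGeometry.Motives.HodgeLieWeightOnePeirceTwo
import HarnessLib

/-!
# Weight one: a minimal raising tripotent never has rank `2` — RIGIDITY on the plane `range B`
# (the `r = 2` case of the rank-twelve crux; Moonen–Zarhin 1999 (2.3), (2.5); the tree's rank-eight `(2,2)` argument)

Family `hodge`, layer `Literature/AlgebraicGeometry/Motives`; THEOREMS ONLY (no definition, no named fact; D-0026).  Written for the
cell `pub-hodgeav-hg6` (LADDER-HodgeAV row 2, TABLE X row 1 `g6.I(1)`: brick N11 of the row-1 programme «`End⁰ = ℚ`, `g = 6` ⟹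
`Hg = Sp₁₂`»; honest framing of that cell: HC / HC_AV / HC_CM NOT proved — unconditional Hodge–Lie linear algebra).

SETTING as in `HodgeLieWeightOnePeirce`: `H` effective polarized of weight `1`, `𝔊 ⊆ 𝔥_ℂ` bracket-closed containing `Θ`, `V_ℂ`
irreducible under `𝔊`, `B ∈ 𝔊` raising, non-zero, of minimal rank `r`, `C = B̄ ∈ 𝔊`, `E = t⁻¹ B C`, `U = range B ⊆ P = V^{1,0}`.

* **`WeightOnePeirce.finrank_range_ne_two`** — `r ≠ 2` (in every dimension).  PROOF (transplant of the RIGIDITY half of the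
  tree's `SymplecticThetaEight.levi_eq_top_of_twoTwo`).  Let `Z₀ = 2t⁻¹[B, C] − Θ ∈ 𝔊` (acting on `P` as the involution `2E − 1`).
  For a degree-zero `Z' ∈ 𝔊` commuting with `Z₀` the raising element `[Z', B]` is its own Peirce-`2` component, hence `= s B`
  (`WeightOnePeirce.peirceTwo_eq_smul`, N7); consequently `Z'|_U` is CONFORMAL for the non-degenerate symmetric form
  `γ(u, v) = ψ_ℂ(C u, v)` on `U`: `γ(Z'u, v) + γ(u, Z'v) = s γ(u, v)`.  If `dim U = 2`, an isotropic `v₀ ≠ 0` of `γ` exists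
  (`SymplecticThetaEight.exists_isotropic`) and `ℂ v₀` is stable under every such `Z'` (`…mem_span_of_orthogonal_isotropic`); by the
  orbit lemma `SymplecticThetaSix.eq_bot_or_eq_of_stable_le` for `(P, 𝔩 = 𝔊|_P, Θ' = 2E − 1)` (irreducibility of `P` under `𝔩`:
  `SymplecticThetaSix.levi_irreducible`) the line `ℂ v₀` is all of `U`, contradicting `dim U = 2`.
* For the cell (`dim_ℚ V = 12`, `End_Hdg = ℚ`): with `rankTwelve_sp_or_simple` (N10) the residual crux is a minimal raising
  tripotent of rank `3` or `4` in a SIMPLE `𝔥_ℂ` (`rankTwelve_sp_or_simple_three_four`).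

## References

* [MoonenZarhin1999LowDim] B. Moonen, Yu. Zarhin, *Hodge classes on abelian varieties of low dimension*, Math. Ann. 315 (1999),
  §2 (2.3)–(2.5), §3 (3.1).
* [Deligne1982HodgeCycles] P. Deligne, *Hodge cycles on abelian varieties*, LNM 900 (1982), I §3 (Prop. 3.4, 3.6).
* [GoodmanWallachGTM255] R. Goodman, N. R. Wallach, GTM 255 (2009), §2.1.2, §4.1.1.
* [HoffmanKunze1971LinearAlgebra] K. Hoffman, R. Kunze, *Linear Algebra* (1971), §10.2 (isotropic vectors of symmetric forms).
-/

noncomputable section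

open scoped TensorProduct

namespace Literature.AlgebraicGeometry.Motives

namespace HodgeStructure

universe u

variable {V : Type u} [AddCommGroup V] [Module ℚ V] [Module.Finite ℚ V] [HodgeTensorFacts.{u, u}] {n : ℤ}

set_option maxHeartbeats 4000000 in
/-- **A minimal raising tripotent never has rank `2`** (`V_ℂ` irreducible under `𝔊`; rigidity on the plane `range B`: every
degree-zero element of `𝔊` commuting with `Z₀ = 2t⁻¹[B, B̄] − Θ` is conformal on `range B` for `ψ_ℂ(B̄ ·, ·)`, so an isotropic line
is stable, contradicting the orbit lemma).
[cite: MoonenZarhin1999LowDim, §2 (2.3)–(2.5)] [cite: Deligne1982HodgeCycles, I §3 Prop. 3.4, Prop. 3.6]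
[cite: GoodmanWallachGTM255, §4.1.1] [cite: HoffmanKunze1971LinearAlgebra, §10.2] -/
theorem WeightOnePeirce.finrank_range_ne_two (H : HodgeStructure V n) (ψ : H.Polarization) (hn : n = 1)
    (heff : H.IsEffective) {Θ : Module.End ℂ (ℂ ⊗[ℚ] V)} (hΘ : ∀ p, ∀ x ∈ H.piece p (n - p), Θ x = ((2 * p - n : ℤ) : ℂ) • x)
    {𝔊 : Submodule ℂ (Module.End ℂ (ℂ ⊗[ℚ] V))} (h𝔊 : 𝔊 ≤ H.hodgeLieC) (hbr : ∀ Y ∈ 𝔊, ∀ Z ∈ 𝔊, Y * Z - Z * Y ∈ 𝔊)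
    (hΘ𝔊 : Θ ∈ 𝔊) (hirr : ∀ U : Submodule ℂ (ℂ ⊗[ℚ] V), (∀ Z ∈ 𝔊, ∀ u ∈ U, Z u ∈ U) → U = ⊥ ∨ U = ⊤)
    {B C : Module.End ℂ (ℂ ⊗[ℚ] V)} (hB : B ∈ 𝔊) (hB0 : B ≠ 0) (hBP : ∀ p ∈ H.piece 1 0, B p = 0)
    (hBim : ∀ v, B v ∈ H.piece 1 0) (hC : ∀ v, C v = conj (B (conj v))) (hC𝔊 : C ∈ 𝔊)
    (hmin : ∀ B' ∈ 𝔊, B' ≠ 0 → (∀ p ∈ H.piece 1 0, B' p = 0) → (∀ v, B' v ∈ H.piece 1 0) →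
      Module.finrank ℂ (LinearMap.range B) ≤ Module.finrank ℂ (LinearMap.range B'))
    (hr2 : Module.finrank ℂ (LinearMap.range B) = 2) : False := by
  classical
  obtain ⟨t, ht, hBCB⟩ := WeightOneMinimalRaising.mul_conjOp_mul_eq_smul H ψ hn heff hΘ h𝔊 hbr hB hB0 hBP hBim hC hC𝔊 hmin
  obtain ⟨hCBC, -⟩ := WeightOnePeirce.conjOp_mul_conjOp_mul hC ht hB0 hBCB
  subst hn
  obtain ⟨hPmem, hQmem, hΘ10, hΘ01, hΘΘ⟩ := UnitaryTheta.theta_facts H rfl heff hΘ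
  set P := H.piece 1 0 with hPdef
  set Q := H.piece 0 1 with hQdef
  set M := ℂ ⊗[ℚ] V
  obtain ⟨hCQ, hCim, hcC, hcB⟩ := SymplecticThetaTen.conjOp_raise (P := P) (Q := Q)
    (fun x hx => conj_mem_piece H hx) (fun x hx => conj_mem_piece H hx) hBP hBim hC
  have hTfix : ∀ x : M, Θ x = x → x ∈ P := fun x hx => by
    have h := hPmem x
    rwa [hx, ← two_smul ℂ x, smul_smul, inv_mul_cancel₀ (two_ne_zero' ℂ), one_smul] at h
  have hBB : B * B = 0 := LinearMap.ext fun v => by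
    rw [Module.End.mul_apply, hBP _ (hBim v), LinearMap.zero_apply]
  have hCC : C * C = 0 := LinearMap.ext fun v => by
    rw [Module.End.mul_apply, hCQ _ (hCim v), LinearMap.zero_apply]
  obtain ⟨E, hE⟩ : ∃ E : Module.End ℂ M, E = t⁻¹ • (B * C) := ⟨_, rfl⟩
  obtain ⟨F, hF⟩ : ∃ F : Module.End ℂ M, F = t⁻¹ • (C * B) := ⟨_, rfl⟩
  obtain ⟨hEE, hFF, hEB, hBF, hFC, hCE, hBE, hFB, hEF, hFE⟩ := WeightOnePeirce.tripotent_facts ht hBCB hCBC hBB hCC hE hF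
  have hEP : ∀ v, E v ∈ P := fun v => by
    rw [hE, LinearMap.smul_apply, Module.End.mul_apply]
    exact Submodule.smul_mem _ _ (hBim _)
  have hEQ : ∀ q ∈ Q, E q = 0 := fun q hq => by
    rw [hE, LinearMap.smul_apply, Module.End.mul_apply, hCQ q hq, map_zero, smul_zero]
  have hFP : ∀ p ∈ P, F p = 0 := fun p hp => by
    rw [hF, LinearMap.smul_apply, Module.End.mul_apply, hBP p hp, map_zero, smul_zero]
  have hFQ : ∀ v, F v ∈ Q := fun v => by
    rw [hF, LinearMap.smul_apply, Module.End.mul_apply]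
    exact Submodule.smul_mem _ _ (hCim _)
  have hrangeE : LinearMap.range E = LinearMap.range B :=
    (WeightOneMinimalRaising.isIdempotentElem_of_mul_conjOp_mul_eq_smul H rfl heff hΘ hBP hBim hC ht hBCB).2.1 |> fun h => by
      rw [hE]; exact h
  -- the form
  set ω := ψ.form.baseChange ℂ with hω
  have hωalt : ∀ x x', ω x x' = -ω x' x := fun x x' => by rw [hω, form_baseChange_swap_of_odd H odd_one ψ x' x]
  have hωnd : ω.Nondegenerate := by rw [hω]; exact ψ.nondegenerate_baseChange
  have h𝔊skew : ∀ Z ∈ 𝔊, ∀ a b, ω (Z a) b + ω a (Z b) = 0 := fun Z hZ a b => by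
    rw [hω, formBaseChange_skew_of_mem_hodgeLieC ψ (h𝔊 hZ), neg_add_cancel]
  have hBsk : ∀ x x', ω (B x) x' = -ω x (B x') := fun x x' => by rw [hω, formBaseChange_skew_of_mem_hodgeLieC ψ (h𝔊 hB)]
  have hCsk : ∀ x x', ω (C x) x' = -ω x (C x') := fun x x' => by rw [hω, formBaseChange_skew_of_mem_hodgeLieC ψ (h𝔊 hC𝔊)]
  have hQQ : ∀ q ∈ Q, ∀ q' ∈ Q, ω q q' = 0 := fun q hq q' hq' =>
    ψ.form_piece_piece (p := 0) (p' := 0) (by norm_num) (by rw [sub_zero]; exact hq) (by rw [sub_zero]; exact hq')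
  have hPQv : ∀ v : M, (2 : ℂ)⁻¹ • (v + Θ v) + (2 : ℂ)⁻¹ • (v - Θ v) = v := fun v => by module
  have hdec := fun Z (hZ : Z ∈ 𝔊) => SymplecticTheta.exists_decomp 𝔊 hbr hΘ𝔊 hΘΘ hΘ10 hΘ01 hPmem hQmem hZ
  have hEFadj : ∀ x x', ω (E x) x' = ω x (F x') := fun x x' => by
    rw [hE, hF, LinearMap.smul_apply, LinearMap.smul_apply, Module.End.mul_apply, Module.End.mul_apply, map_smul,
      LinearMap.smul_apply, map_smul, smul_eq_mul, smul_eq_mul, hBsk, hCsk, neg_neg]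
  have hFEadj : ∀ x x', ω (F x) x' = ω x (E x') := fun x x' => by rw [hωalt, ← hEFadj, hωalt, neg_neg]
  -- `E` restricted to `P`: the idempotent `Ex` with `range Ex ≅ U`, and `Ey = 1 - Ex`
  have hEP' : ∀ p ∈ P, E p ∈ P := fun p _ => hEP p
  set Ex : Module.End ℂ ↥P := E.restrict hEP' with hExdef
  set Ey : Module.End ℂ ↥P := 1 - Ex with hEydef
  have hExv : ∀ p : ↥P, ((Ex p : ↥P) : M) = E p := fun p => rfl
  have hsumv : ∀ p : ↥P, Ex p + Ey p = p := fun p => by rw [hEydef, LinearMap.sub_apply, Module.End.one_apply]; abel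
  have hsumM : ∀ p : ↥P, ((Ex p : ↥P) : M) + ((Ey p : ↥P) : M) = p := fun p => by
    rw [← Submodule.coe_add, hsumv]
  have hExxv : ∀ p : ↥P, Ex (Ex p) = Ex p := fun p => by
    apply Subtype.ext
    rw [hExv, hExv, ← Module.End.mul_apply, hEE]
  have hExyv : ∀ p : ↥P, Ex (Ey p) = 0 := fun p => by
    rw [hEydef, LinearMap.sub_apply, Module.End.one_apply, map_sub, hExxv, sub_self]
  have hEyxv : ∀ p : ↥P, Ey (Ex p) = 0 := fun p => by
    rw [hEydef, LinearMap.sub_apply, Module.End.one_apply, hExxv, sub_self]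
  have hEy_of_Ex : ∀ p : ↥P, Ex p = p → Ey p = 0 := fun p hp => by
    rw [hEydef, LinearMap.sub_apply, Module.End.one_apply, hp, sub_self]
  have hmem_range : ∀ p : ↥P, p ∈ LinearMap.range Ex ↔ Ex p = p := by
    intro p
    constructor
    · rintro ⟨q, rfl⟩; exact hExxv q
    · intro h; exact ⟨p, h⟩
  have hPa2 : Module.finrank ℂ (LinearMap.range Ex) = 2 := by
    have hmap : Submodule.map P.subtype (LinearMap.range Ex) = LinearMap.range B := by
      rw [← hrangeE]
      apply le_antisymm
      · rintro _ ⟨p, ⟨q, rfl⟩, rfl⟩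
        exact ⟨(q : M), (hExv q).symm⟩
      · rintro _ ⟨v, rfl⟩
        refine ⟨⟨E v, hEP v⟩, ⟨⟨E v, hEP v⟩, Subtype.ext ?_⟩, rfl⟩
        rw [hExv, ← Module.End.mul_apply, hEE]
    rw [← Submodule.finrank_map_subtype_eq P (LinearMap.range Ex), hmap, hr2]
  -- the involution `Z₀ = 2 t⁻¹ [B, C] − Θ` of `𝔊`, acting on `P` as `Ex − Ey`
  obtain ⟨Z₀, hZ₀def⟩ : ∃ Z₀ : Module.End ℂ M, Z₀ = (2 : ℂ) • (t⁻¹ • (B * C - C * B)) - Θ := ⟨_, rfl⟩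
  have hZ₀𝔊 : Z₀ ∈ 𝔊 := by
    rw [hZ₀def]
    exact Submodule.sub_mem _ (Submodule.smul_mem _ _ (Submodule.smul_mem _ _ (hbr B hB C hC𝔊))) hΘ𝔊
  have hhEF : t⁻¹ • (B * C - C * B) = E - F := by rw [smul_sub, hE, hF]
  have hZ₀v : ∀ v, Z₀ v = (2 : ℂ) • (E v - F v) - Θ v := fun v => by
    rw [hZ₀def, hhEF, LinearMap.sub_apply, LinearMap.smul_apply, LinearMap.sub_apply]
  have hZ₀apply : ∀ p : ↥P, Z₀ p = ((Ex p : ↥P) : M) - ((Ey p : ↥P) : M) := fun p => by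
    rw [hZ₀v, hFP _ p.2, sub_zero, hΘ10 _ p.2, hEydef, LinearMap.sub_apply, Module.End.one_apply, Submodule.coe_sub,
      hExv, two_smul]
    abel
  have hZ₀PP : ∀ p ∈ P, Z₀ p ∈ P := fun p hp => by
    rw [hZ₀v, hFP p hp, sub_zero, hΘ10 p hp]
    exact Submodule.sub_mem _ (Submodule.smul_mem _ _ (hEP p)) hp
  have hZ₀QQ : ∀ q ∈ Q, Z₀ q ∈ Q := fun q hq => by
    rw [hZ₀v, hEQ q hq, zero_sub, hΘ01 q hq, sub_neg_eq_add]
    exact Submodule.add_mem _ (Submodule.smul_mem _ _ (Submodule.neg_mem _ (hFQ q))) hq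
  -- `Ex`, `Ey` lift to `𝔊`
  have hEx𝔩 : ∃ Z ∈ 𝔊, ∀ p : ↥P, ((Ex p : ↥P) : M) = Z p :=
    ⟨t⁻¹ • (B * C - C * B), Submodule.smul_mem _ _ (hbr B hB C hC𝔊), fun p => by
      rw [hExv, hhEF, LinearMap.sub_apply, hFP _ p.2, sub_zero]⟩
  have hEy𝔩 : ∃ Z ∈ 𝔊, ∀ p : ↥P, ((Ey p : ↥P) : M) = Z p :=
    ⟨Θ - t⁻¹ • (B * C - C * B), Submodule.sub_mem _ hΘ𝔊 (Submodule.smul_mem _ _ (hbr B hB C hC𝔊)), fun p => by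
      rw [hEydef, LinearMap.sub_apply, Module.End.one_apply, Submodule.coe_sub, hExv, hhEF, LinearMap.sub_apply,
        LinearMap.sub_apply, hFP _ p.2, sub_zero, hΘ10 _ p.2]⟩
  -- `E_x` in terms of `Z₀`, and degree-zero operators commuting with `Z₀` commute with `E` on `P`
  have hExZ₀ : ∀ p : ↥P, ((Ex p : ↥P) : M) = (2 : ℂ)⁻¹ • (Z₀ p + p) := fun p => by
    rw [hZ₀apply]
    have h := hsumM p
    have h' : ((Ey p : ↥P) : M) = (p : M) - ((Ex p : ↥P) : M) := by rw [← h]; abel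
    rw [h']
    module
  have hExW : ∀ W : Module.End ℂ M, (∀ p ∈ P, W p ∈ P) → W * Z₀ = Z₀ * W →
      ∀ (p : ↥P) (hWp : W p ∈ P), ((Ex ⟨W p, hWp⟩ : ↥P) : M) = W ((Ex p : ↥P) : M) := by
    intro W hWP hWZ p hWp
    rw [hExZ₀, hExZ₀, map_smul, map_add]
    change (2 : ℂ)⁻¹ • (Z₀ (W p) + W p) = (2 : ℂ)⁻¹ • (W (Z₀ p) + W p)
    rw [← Module.End.mul_apply, ← hWZ, Module.End.mul_apply]
  -- such operators commute with `E` and `F` on all of `V_ℂ`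
  have hWE : ∀ W : Module.End ℂ M, (∀ p ∈ P, W p ∈ P) → (∀ q ∈ Q, W q ∈ Q) → W * Z₀ = Z₀ * W →
      W * E = E * W ∧ W * F = F * W := by
    intro W hWP hWQ hWZ
    have hEW : ∀ v, E (W v) = W (E v) := fun v => by
      conv_lhs => rw [← hPQv v]
      conv_rhs => rw [← hPQv v]
      rw [map_add, map_add, map_add, map_add, hEQ _ (hWQ _ (hQmem v)), hEQ _ (hQmem v), map_zero, add_zero, add_zero]
      have h := hExW W hWP hWZ ⟨_, hPmem v⟩ (hWP _ (hPmem v))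
      rw [hExv, hExv] at h
      exact h
    have hW2 : ∀ v, W (Z₀ v) = Z₀ (W v) := fun v => by rw [← Module.End.mul_apply, hWZ, Module.End.mul_apply]
    have hWΘ : ∀ v, W (Θ v) = Θ (W v) := fun v => by
      conv_lhs => rw [← hPQv v]
      conv_rhs => rw [← hPQv v]
      rw [map_add, hΘ10 _ (hPmem v), hΘ01 _ (hQmem v), map_add, map_neg, map_add, map_add, hΘ10 _ (hWP _ (hPmem v)),
        hΘ01 _ (hWQ _ (hQmem v))]
    refine ⟨LinearMap.ext fun v => ?_, LinearMap.ext fun v => ?_⟩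
    · rw [Module.End.mul_apply, Module.End.mul_apply, hEW]
    · rw [Module.End.mul_apply, Module.End.mul_apply]
      -- `F = E - ½ (Z₀ + Θ)`
      have hFv : ∀ x, F x = E x - (2 : ℂ)⁻¹ • (Z₀ x + Θ x) := fun x => by rw [hZ₀v]; module
      rw [hFv, hFv, map_sub, map_smul, map_add, hEW, hW2, hWΘ]
  -- `[Z', B] = s B` for degree-zero `Z'` commuting with `Z₀` (the Peirce-2 space is a line)
  have hdeg : ∀ Z' ∈ 𝔊, (∀ p ∈ P, Z' p ∈ P) → (∀ q ∈ Q, Z' q ∈ Q) → Z' * Z₀ = Z₀ * Z' →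
      ∃ s : ℂ, Z' * B - B * Z' = s • B := by
    intro Z' hZ' hZ'P hZ'Q hZ'Z
    obtain ⟨hZ'E, hZ'F⟩ := hWE Z' hZ'P hZ'Q hZ'Z
    have hx : Z' * B - B * Z' ∈ 𝔊 := hbr Z' hZ' B hB
    have hxP : ∀ p ∈ P, (Z' * B - B * Z') p = 0 := fun p hp => by
      rw [LinearMap.sub_apply, Module.End.mul_apply, Module.End.mul_apply, hBP p hp, map_zero, hBP _ (hZ'P p hp), sub_zero]
    have hxim : ∀ v, (Z' * B - B * Z') v ∈ P := fun v => by
      rw [LinearMap.sub_apply, Module.End.mul_apply, Module.End.mul_apply]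
      exact Submodule.sub_mem _ (hZ'P _ (hBim v)) (hBim _)
    obtain ⟨s, hs⟩ := WeightOnePeirce.peirceTwo_eq_smul H ψ rfl heff hΘ h𝔊 hbr hB hB0 hBP hBim hC hC𝔊 hmin ht hBCB hx hxP hxim
    refine ⟨s, ?_⟩
    rw [← hE, ← hF] at hs
    rw [← hs, mul_sub, sub_mul, ← mul_assoc E Z' B, ← hZ'E, mul_assoc Z' E B, hEB, mul_assoc Z' B F, hBF,
      ← mul_assoc E B Z', hEB, mul_assoc B Z' F, hZ'F, ← mul_assoc B F Z', hBF]
  -- the symmetric form `γ(u, v) = ψ_ℂ(C u, v)` on `P`, through the subtype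
  let γ : M →ₗ[ℂ] M →ₗ[ℂ] ℂ := ω ∘ₗ C
  have hγ : ∀ u v : M, γ u v = ω (C u) v := fun u v => rfl
  have hγsymm : ∀ u v : M, γ u v = γ v u := fun u v => by
    rw [hγ, hγ, hCsk, hωalt u, neg_neg]
  let γP : ↥P →ₗ[ℂ] ↥P →ₗ[ℂ] ℂ := γ.compl₁₂ P.subtype P.subtype
  have hγP : ∀ u v : ↥P, γP u v = ω (C u) v := fun u v => rfl
  have hγPsymm : ∀ u v : ↥P, γP u v = γP v u := fun u v => hγsymm u v
  -- (★) conformality: `γ(Z'u, v) + γ(u, Z'v) = s γ(u, v)` on `U`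
  have hstar : ∀ Z' ∈ 𝔊, (∀ p ∈ P, Z' p ∈ P) → (∀ q ∈ Q, Z' q ∈ Q) → Z' * Z₀ = Z₀ * Z' →
      ∃ s : ℂ, ∀ u v : M, E u = u → E v = v → ω (C (Z' u)) v + ω (C u) (Z' v) = s * ω (C u) v := by
    intro Z' hZ' hZ'P hZ'Q hZ'Z
    obtain ⟨s, hs⟩ := hdeg Z' hZ' hZ'P hZ'Q hZ'Z
    refine ⟨s, fun u v hu hv => ?_⟩
    -- `u = B w₁` with `w₁ = t⁻¹ C u`, and `Z' u = B (Z' w₁) + s u`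
    obtain ⟨w₁, hw₁⟩ : ∃ w₁ : M, w₁ = t⁻¹ • C u := ⟨_, rfl⟩
    have hu' : B w₁ = u := by
      rw [hw₁, map_smul, ← Module.End.mul_apply, ← LinearMap.smul_apply, ← hE, hu]
    have hZ'u : Z' u = B (Z' w₁) + s • u := by
      have h := LinearMap.congr_fun hs w₁
      rw [LinearMap.sub_apply, Module.End.mul_apply, Module.End.mul_apply, LinearMap.smul_apply, hu'] at h
      rw [← h]
      abel
    have hCB : C * B = t • F := by rw [hF, smul_smul, mul_inv_cancel₀ ht, one_smul]
    -- `ω (C B z, v) = t ω (F z, v) = t ω (z, E v) = t ω(z, v)`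
    have h1 : ω (C (B (Z' w₁))) v = -ω (C u) (Z' v) := by
      have e1 : C (B (Z' w₁)) = t • F (Z' w₁) := by rw [← Module.End.mul_apply C B, hCB, LinearMap.smul_apply]
      have e2 : ω (Z' w₁) v = -ω w₁ (Z' v) := by
        have h := h𝔊skew Z' hZ' w₁ v
        linear_combination h
      rw [e1, map_smul, LinearMap.smul_apply, smul_eq_mul, hFEadj, hv, e2, hw₁, map_smul, LinearMap.smul_apply,
        smul_eq_mul, mul_neg, ← mul_assoc, mul_inv_cancel₀ ht, one_mul]
    rw [hZ'u, map_add, map_smul, map_add, map_smul, LinearMap.add_apply, LinearMap.smul_apply, smul_eq_mul, h1]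
    ring
  -- non-degeneracy of `γ` on `range Ex`
  have hnd : ∀ u ∈ LinearMap.range Ex, (∀ v ∈ LinearMap.range Ex, γP u v = 0) → u = 0 := by
    intro u hu huv
    rw [hmem_range] at hu
    have hEu : E u = u := by rw [← hExv, hu]
    have hCu : C u = 0 := by
      refine hωnd.1 _ fun z => ?_
      rw [← hPQv z, map_add, hQQ _ (hCim _) _ (hQmem z), add_zero]
      set p : ↥P := ⟨(2 : ℂ)⁻¹ • (z + Θ z), hPmem z⟩ with hpdef
      have hp : ((2 : ℂ)⁻¹ • (z + Θ z) : M) = (p : M) := rfl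
      rw [hp, ← hsumM p, map_add]
      have h1 : ω (C u) ((Ex p : ↥P) : M) = 0 := huv (Ex p) ⟨p, rfl⟩
      have h2 : ω (C u) ((Ey p : ↥P) : M) = 0 := by
        -- `Ey p ∈ ker E ∩ P` is `ω`-orthogonal to `C u ∈ W = C(U)`: `ω(C u, u') = -ω(u, C u') = -ω(u, C E u') = 0`
        have hEy0 : E ((Ey p : ↥P) : M) = 0 := by rw [← hExv, hExyv, Submodule.coe_zero]
        rw [hCsk, ← hCE, Module.End.mul_apply, hEy0, map_zero, map_zero, neg_zero]
      rw [h1, h2, add_zero]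
    have h : (u : M) = 0 := by
      rw [← hEu, hE, LinearMap.smul_apply, Module.End.mul_apply, hCu, map_zero, smul_zero]
    exact Subtype.ext h
  -- an isotropic vector `v₀ ∈ range Ex`
  obtain ⟨v₀, hv₀mem, hv₀0, hv₀⟩ := SymplecticThetaEight.exists_isotropic γP hγPsymm hPa2
  have hv₀fix : Ex v₀ = v₀ := (hmem_range v₀).1 hv₀mem
  have hEv₀ : E v₀ = v₀ := by rw [← hExv, hv₀fix]
  -- every degree-zero `Z' ∈ 𝔊` commuting with `Z₀` maps `v₀` into `ℂ v₀`
  have hline : ∀ (Z' : Module.End ℂ M) (_ : Z' ∈ 𝔊) (hZ'P : ∀ p ∈ P, Z' p ∈ P)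
      (_ : ∀ q ∈ Q, Z' q ∈ Q) (_ : Z' * Z₀ = Z₀ * Z'),
      (⟨Z' v₀, hZ'P _ v₀.2⟩ : ↥P) ∈ Submodule.span ℂ ({v₀} : Set ↥P) := by
    intro Z' hZ'𝔊 hZ'P hZ'Q hZ'Z
    obtain ⟨s, hs⟩ := hstar Z' hZ'𝔊 hZ'P hZ'Q hZ'Z
    have hZv : Ex ⟨Z' v₀, hZ'P _ v₀.2⟩ = ⟨Z' v₀, hZ'P _ v₀.2⟩ := by
      apply Subtype.ext; rw [hExW Z' hZ'P hZ'Z v₀ (hZ'P _ v₀.2), hv₀fix]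
    have hZvmem : (⟨Z' v₀, hZ'P _ v₀.2⟩ : ↥P) ∈ LinearMap.range Ex := (hmem_range _).2 hZv
    refine SymplecticThetaEight.mem_span_of_orthogonal_isotropic γP hγPsymm hPa2 hnd hv₀mem hv₀0 hv₀ hZvmem ?_
    have h := hs v₀ v₀ hEv₀ hEv₀
    have h0 : ω (C v₀) v₀ = 0 := hv₀
    have hsym : ω (C v₀) (Z' v₀) = ω (C (Z' v₀)) v₀ := hγsymm (v₀ : M) (Z' v₀)
    rw [h0, mul_zero, hsym, ← two_mul] at h
    have h' : ω (C (Z' v₀)) v₀ = 0 := (mul_eq_zero.1 h).resolve_left two_ne_zero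
    exact h'
  -- the Levi line algebra `𝔩` and the orbit lemma for `Θ' = E_x − E_y`
  let 𝔩 : Submodule ℂ (Module.End ℂ ↥P) :=
    { carrier := {A | ∃ Z ∈ 𝔊, ∀ p : ↥P, ((A p : ↥P) : M) = Z p}
      zero_mem' := ⟨0, Submodule.zero_mem _, fun p => by simp⟩
      add_mem' := by
        rintro A A' ⟨Z, hZ, hAZ⟩ ⟨Z', hZ', hAZ'⟩
        exact ⟨Z + Z', Submodule.add_mem _ hZ hZ', fun p => by
          rw [LinearMap.add_apply, Submodule.coe_add, hAZ, hAZ', LinearMap.add_apply]⟩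
      smul_mem' := by
        rintro c A ⟨Z, hZ, hAZ⟩
        exact ⟨c • Z, Submodule.smul_mem _ _ hZ, fun p => by
          rw [LinearMap.smul_apply, Submodule.coe_smul, hAZ, LinearMap.smul_apply]⟩ }
  have hmem𝔩 : ∀ A, A ∈ 𝔩 ↔ ∃ Z ∈ 𝔊, ∀ p : ↥P, ((A p : ↥P) : M) = Z p := fun A => Iff.rfl
  have h𝔩br : ∀ A ∈ 𝔩, ∀ A' ∈ 𝔩, A * A' - A' * A ∈ 𝔩 := by
    intro A hA' A' hA''
    obtain ⟨Z, hZ, hAZ⟩ := (hmem𝔩 A).1 hA'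
    obtain ⟨Z', hZ', hAZ'⟩ := (hmem𝔩 A').1 hA''
    refine (hmem𝔩 _).2 ⟨Z * Z' - Z' * Z, hbr _ hZ _ hZ', fun p => ?_⟩
    rw [LinearMap.sub_apply, Submodule.coe_sub, Module.End.mul_apply, Module.End.mul_apply, hAZ, hAZ', hAZ',
      hAZ, LinearMap.sub_apply, Module.End.mul_apply, Module.End.mul_apply]
  have h𝔩irr : ∀ U : Submodule ℂ ↥P, (∀ A ∈ 𝔩, ∀ u ∈ U, A u ∈ U) → U = ⊥ ∨ U = ⊤ := by
    intro U hU
    refine SymplecticThetaSix.levi_irreducible (𝔊) hbr hΘ𝔊 hΘΘ hΘ10 hΘ01 hPmem hQmem hirr U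
      fun Z hZ hZP u hu => ?_
    exact hU _ ((hmem𝔩 _).2 ⟨Z, hZ, fun p => rfl⟩) u hu
  set Θ' : Module.End ℂ ↥P := Ex - Ey with hΘ'def
  have hΘ'𝔩 : Θ' ∈ 𝔩 := by
    obtain ⟨Zx, hZx, hZxE⟩ := hEx𝔩
    obtain ⟨Zy, hZy, hZyE⟩ := hEy𝔩
    exact (hmem𝔩 _).2 ⟨Zx - Zy, Submodule.sub_mem _ hZx hZy, fun p => by
      rw [hΘ'def, LinearMap.sub_apply, Submodule.coe_sub, hZxE, hZyE, LinearMap.sub_apply]⟩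
  have hΘ'apply : ∀ p : ↥P, Θ' p = Ex p - Ey p := fun p => rfl
  have hΘ'Θ' : ∀ p : ↥P, Θ' (Θ' p) = p := fun p => by
    rw [hΘ'apply, hΘ'apply, map_sub, map_sub, hExxv, hExyv, hEyxv, sub_zero, zero_sub, sub_neg_eq_add]
    have h := hsumv (Ey p)
    rw [hExyv, zero_add] at h
    rw [h, hsumv]
  have hΘ'fix : ∀ p ∈ LinearMap.range Ex, Θ' p = p := fun p hp => by
    rw [hmem_range] at hp
    rw [hΘ'apply, hEy_of_Ex p hp, sub_zero, hp]
  have hΘ'neg : ∀ p ∈ LinearMap.range Ey, Θ' p = -p := by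
    rintro _ ⟨q, rfl⟩
    rw [hΘ'apply, hExyv, zero_sub]
    have h := hsumv (Ey q)
    rw [hExyv, zero_add] at h
    rw [h]
  have hΘ'Pmem : ∀ p : ↥P, (2 : ℂ)⁻¹ • (p + Θ' p) ∈ LinearMap.range Ex := fun p => by
    refine ⟨p, ?_⟩
    rw [hΘ'apply]
    have h' : Ey p = p - Ex p := eq_sub_of_add_eq (by rw [add_comm]; exact hsumv p)
    rw [h']
    module
  have hΘ'Qmem : ∀ p : ↥P, (2 : ℂ)⁻¹ • (p - Θ' p) ∈ LinearMap.range Ey := fun p => by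
    refine ⟨p, ?_⟩
    rw [hΘ'apply]
    have h' : Ex p = p - Ey p := eq_sub_of_add_eq (hsumv p)
    rw [h']
    module
  -- the line `ℂ v₀` is stable under every element of `𝔩` preserving `E_x P`
  set U : Submodule ℂ ↥P := Submodule.span ℂ ({v₀} : Set ↥P) with hUdef
  have hUle : U ≤ LinearMap.range Ex := by
    rw [hUdef, Submodule.span_le, Set.singleton_subset_iff]; exact hv₀mem
  have hUstab : ∀ A ∈ 𝔩, (∀ p ∈ LinearMap.range Ex, A p ∈ LinearMap.range Ex) → ∀ u ∈ U, A u ∈ U := by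
    intro A hA𝔩 hAP u hu
    obtain ⟨c, rfl⟩ := Submodule.mem_span_singleton.1 hu
    rw [map_smul]
    refine Submodule.smul_mem _ _ ?_
    -- a degree-zero lift `Z` of `A`, and the `Θ'`-diagonal lift `Zd = Z − ¼ [Z₀, [Z₀, Z]]`
    obtain ⟨Z, hZ𝔊, hAZ⟩ := (hmem𝔩 A).1 hA𝔩
    obtain ⟨Zm, -, Z0, hZ0𝔊, Zp, -, -, -, -, -, -, hZ0P, -, hZ0PP, hZ0QQ⟩ := hdec Z hZ𝔊
    have hZ0apply : ∀ p : ↥P, Z0 p = ((A p : ↥P) : M) := fun p => by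
      have hZpP : Z p ∈ P := by rw [← hAZ]; exact (A p).2
      rw [hZ0P p p.2, hΘ10 _ hZpP, ← two_smul ℂ (Z (p : M)), smul_smul, inv_mul_cancel₀ (two_ne_zero' ℂ),
        one_smul, hAZ]
    set Zd : Module.End ℂ M := Z0 - (4 : ℂ)⁻¹ • (Z₀ * (Z₀ * Z0 - Z0 * Z₀) - (Z₀ * Z0 - Z0 * Z₀) * Z₀)
      with hZddef
    have hZd𝔊 : Zd ∈ 𝔊 :=
      Submodule.sub_mem _ hZ0𝔊 (Submodule.smul_mem _ _ (hbr _ hZ₀𝔊 _ (hbr _ hZ₀𝔊 _ hZ0𝔊)))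
    have hZdapply : ∀ v, Zd v = Z0 v - (4 : ℂ)⁻¹ • (Z₀ (Z₀ (Z0 v)) - Z₀ (Z0 (Z₀ v)) -
        (Z₀ (Z0 (Z₀ v)) - Z0 (Z₀ (Z₀ v)))) := fun v => by
      rw [hZddef]; simp only [LinearMap.sub_apply, LinearMap.smul_apply, Module.End.mul_apply, map_sub]
    have hZdP : ∀ p ∈ P, Zd p ∈ P := by
      intro p hp
      rw [hZdapply]
      refine Submodule.sub_mem _ (hZ0PP p hp) (Submodule.smul_mem _ _ (Submodule.sub_mem _
        (Submodule.sub_mem _ (hZ₀PP _ (hZ₀PP _ (hZ0PP p hp))) (hZ₀PP _ (hZ0PP _ (hZ₀PP p hp))))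
        (Submodule.sub_mem _ (hZ₀PP _ (hZ0PP _ (hZ₀PP p hp))) (hZ0PP _ (hZ₀PP _ (hZ₀PP p hp))))))
    have hZdQ : ∀ q ∈ Q, Zd q ∈ Q := by
      intro q hq
      rw [hZdapply]
      refine Submodule.sub_mem _ (hZ0QQ q hq) (Submodule.smul_mem _ _ (Submodule.sub_mem _
        (Submodule.sub_mem _ (hZ₀QQ _ (hZ₀QQ _ (hZ0QQ q hq))) (hZ₀QQ _ (hZ0QQ _ (hZ₀QQ q hq))))
        (Submodule.sub_mem _ (hZ₀QQ _ (hZ0QQ _ (hZ₀QQ q hq))) (hZ0QQ _ (hZ₀QQ _ (hZ₀QQ q hq))))))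
    -- `Z₀` acts on `P` as `Θ'`
    have hZ₀Θ' : ∀ p : ↥P, Z₀ p = ((Θ' p : ↥P) : M) := fun p => by
      rw [hZ₀apply, hΘ'apply, Submodule.coe_sub]
    have hZ₀P' : ∀ p : ↥P, Z₀ p ∈ P := fun p => hZ₀PP _ p.2
    -- on `P`, `Zd` is the `Θ'`-diagonal part `½ (A + Θ' A Θ')`
    have hZdP' : ∀ p : ↥P, Zd p = (2 : ℂ)⁻¹ • (((A p : ↥P) : M) + ((Θ' (A (Θ' p)) : ↥P) : M)) := by
      intro p
      have e1 : Z0 (Z₀ p) = ((A (Θ' p) : ↥P) : M) := by rw [hZ₀Θ']; exact hZ0apply (Θ' p)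
      have e2 : Z₀ (Z0 (Z₀ p)) = ((Θ' (A (Θ' p)) : ↥P) : M) := by rw [e1]; exact hZ₀Θ' _
      have e3 : Z₀ (Z0 p) = ((Θ' (A p) : ↥P) : M) := by rw [hZ0apply]; exact hZ₀Θ' _
      have e4 : Z₀ (Z₀ (Z0 p)) = ((A p : ↥P) : M) := by
        rw [e3, hZ₀Θ', hΘ'Θ']
      have e5 : Z0 (Z₀ (Z₀ p)) = ((A p : ↥P) : M) := by
        rw [hZ₀Θ', hZ₀Θ', hΘ'Θ', hZ0apply]
      rw [hZdapply, e4, e2, e5, hZ0apply]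
      module
    -- `Zd` commutes with `Z₀` (check on `P`, then `eq_zero_of_skew_of_apply_piece_eq_zero`)
    have hZdZ : Zd * Z₀ = Z₀ * Zd := by
      rw [← sub_eq_zero]
      set X : Module.End ℂ M := Zd * Z₀ - Z₀ * Zd with hXdef
      have hX𝔊 : X ∈ 𝔊 := hbr _ hZd𝔊 _ hZ₀𝔊
      have hXQ : ∀ q ∈ Q, X q ∈ Q := fun q hq => by
        rw [hXdef, LinearMap.sub_apply, Module.End.mul_apply, Module.End.mul_apply]
        exact Submodule.sub_mem _ (hZdQ _ (hZ₀QQ q hq)) (hZ₀QQ _ (hZdQ q hq))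
      have hXP : ∀ p ∈ P, X p = 0 := by
        intro p hp
        rw [hXdef, LinearMap.sub_apply, Module.End.mul_apply, Module.End.mul_apply]
        have e1 : Zd (Z₀ p) = (2 : ℂ)⁻¹ • (((A (Θ' ⟨p, hp⟩) : ↥P) : M) + ((Θ' (A ⟨p, hp⟩) : ↥P) : M)) := by
          have h := hZdP' (Θ' ⟨p, hp⟩)
          rw [hΘ'Θ'] at h
          rw [show Z₀ p = ((Θ' ⟨p, hp⟩ : ↥P) : M) from hZ₀Θ' ⟨p, hp⟩, h]
        have e2 : Z₀ (Zd p) = (2 : ℂ)⁻¹ • (((Θ' (A ⟨p, hp⟩) : ↥P) : M) + ((A (Θ' ⟨p, hp⟩) : ↥P) : M)) := by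
          have h := hZdP' ⟨p, hp⟩
          rw [show Zd p = (((2 : ℂ)⁻¹ • (A ⟨p, hp⟩ + Θ' (A (Θ' ⟨p, hp⟩))) : ↥P) : M) by
            rw [h, Submodule.coe_smul, Submodule.coe_add], hZ₀Θ', map_smul, map_add, hΘ'Θ', Submodule.coe_smul,
            Submodule.coe_add]
        rw [e1, e2]
        module
      exact SymplecticThetaEight.eq_zero_of_skew_of_apply_piece_eq_zero H rfl heff ψ hΘ (h𝔊skew X hX𝔊) hXQ hXP
    -- hence `Zd v₀ ∈ ℂ v₀`; and `Zd v₀ = A v₀` since `A v₀ ∈ E_x P`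
    have hl := hline Zd hZd𝔊 hZdP hZdQ hZdZ
    have hAv₀ : A v₀ ∈ LinearMap.range Ex := hAP v₀ hv₀mem
    have hZdv₀ : Zd v₀ = ((A v₀ : ↥P) : M) := by
      rw [hZdP', hΘ'fix v₀ hv₀mem, hΘ'fix _ hAv₀]
      module
    have heq : (⟨Zd v₀, hZdP _ v₀.2⟩ : ↥P) = A v₀ := Subtype.ext hZdv₀
    rw [← heq]
    exact hl
  rcases SymplecticThetaSix.eq_bot_or_eq_of_stable_le 𝔩 h𝔩br hΘ'𝔩 hΘ'Θ' hΘ'fix hΘ'neg hΘ'Pmem hΘ'Qmem h𝔩irr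
    U hUle hUstab with hbot | htop
  · have : v₀ ∈ U := Submodule.subset_span (Set.mem_singleton _)
    rw [hbot, Submodule.mem_bot] at this
    exact hv₀0 this
  · have h1 : Module.finrank ℂ ↥U ≤ 1 := by
      rw [hUdef]; exact finrank_span_le_card ({v₀} : Set ↥P) |>.trans (by simp)
    rw [htop, hPa2] at h1
    omega


/-- **Rank twelve, `End_Hdg = ℚ`: `Lie Hg ⊗ ℂ = 𝔰𝔭(V_ℂ, ψ_ℂ)`, or `Lie Hg ⊗ ℂ` is simple with a minimal raising tripotent of rank
`3` or `4`** (N10 `rankTwelve_sp_or_simple` with the rank-`2` case removed by `WeightOnePeirce.finrank_range_ne_two`).  This is the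
exact residual crux of the cell's TABLE X row 1 after N11. [cite: MoonenZarhin1999LowDim, §2 (2.3)–(2.5) and §3 (3.1)]
[cite: Deligne1982HodgeCycles, I §3 Prop. 3.4, Prop. 3.6] -/
theorem rankTwelve_sp_or_simple_three_four (H : HodgeStructure V n) (hn : n = 1) (heff : H.IsEffective)
    (ψ : H.Polarization) (hE : ∀ a ∈ H.endAlg, ∃ x : ℚ, a = x • (1 : Module.End ℚ V)) (hV : Module.finrank ℚ V = 12) :
    (∀ Y : Module.End ℂ (ℂ ⊗[ℚ] V),
        (∀ x y, ψ.form.baseChange ℂ (Y x) y + ψ.form.baseChange ℂ x (Y y) = 0) → Y ∈ H.hodgeLieC) ∨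
      ((∃ B C : Module.End ℂ (ℂ ⊗[ℚ] V), B ∈ H.hodgeLieC ∧ B ≠ 0 ∧ (∀ p ∈ H.piece 1 0, B p = 0) ∧
          (∀ v, B v ∈ H.piece 1 0) ∧ (∀ v, C v = conj (B (conj v))) ∧
          (∀ B' ∈ H.hodgeLieC, B' ≠ 0 → (∀ p ∈ H.piece 1 0, B' p = 0) → (∀ v, B' v ∈ H.piece 1 0) →
            Module.finrank ℂ (LinearMap.range B) ≤ Module.finrank ℂ (LinearMap.range B')) ∧
          3 ≤ Module.finrank ℂ (LinearMap.range B) ∧ Module.finrank ℂ (LinearMap.range B) ≤ 4) ∧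
        ∀ T : Submodule ℂ (Module.End ℂ (ℂ ⊗[ℚ] V)), T ≤ H.hodgeLieC → T ≠ ⊥ →
          (∀ Y ∈ H.hodgeLieC, ∀ t ∈ T, Y * t - t * Y ∈ T) → T = H.hodgeLieC) := by
  classical
  rcases rankTwelve_sp_or_simple H hn heff ψ hE hV with h | ⟨⟨B, C, hB, hB0, hBP, hBim, hC, hmin, h2, h4⟩, hsimple⟩
  · exact Or.inl h
  · right
    refine ⟨⟨B, C, hB, hB0, hBP, hBim, hC, hmin, ?_, h4⟩, hsimple⟩
    obtain ⟨hbr, hskew, -, Θ, hΘ, hΘ𝔤⟩ := hodgeLie_standing H ψ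
    have hspan : H.hodgeLieC = spanC H.hodgeLie := hodgeLieC_eq_spanC H
    have hΘC : Θ ∈ H.hodgeLieC := by rw [hspan]; exact hΘ𝔤
    have hbrC : ∀ Y ∈ H.hodgeLieC, ∀ Z ∈ H.hodgeLieC, Y * Z - Z * Y ∈ H.hodgeLieC := fun Y hY Z hZ => by
      rw [hspan] at hY hZ ⊢
      exact commutator_mem_spanC hbr hY hZ
    have hirr : ∀ U : Submodule ℂ (ℂ ⊗[ℚ] V), (∀ Z ∈ H.hodgeLieC, ∀ u ∈ U, Z u ∈ U) → U = ⊥ ∨ U = ⊤ :=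
      fun U hU => SymplecticTheta.eq_bot_or_top_of_stable H hn heff ψ hE H.hodgeLie hΘ hΘ𝔤 hskew
        fun X hX u hu => hU _ (by rw [hspan]; exact baseChange_mem_spanC hX) u hu
    have hC𝔊 : C ∈ H.hodgeLieC := by
      rw [hspan] at hB ⊢
      exact conjOp_mem_spanC hB hC
    by_contra hlt
    have hr2 : Module.finrank ℂ (LinearMap.range B) = 2 := by omega
    exact WeightOnePeirce.finrank_range_ne_two H ψ hn heff hΘ le_rfl hbrC hΘC hirr hB hB0 hBP hBim hC hC𝔊 hmin hr2

end HodgeStructure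

end Literature.AlgebraicGeometry.Motives
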